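import Mathlib
import Literature.Analysis.PDE.KernelTransferBounds
import HarnessLib

/-!
# Kernel transfer, step 2: the energy distance in family form

Analysis support file (everything proved, no definitions). With the six error families of
`KernelTransferBounds.lean` (`uVA, uVB, uPA, uPB, dPA, dPB`, characterised by their defining
equations) and a potential `0 ≤ V ≤ W₀x⁻²` on `[x₁,∞)`, the energy density of the difference between
the true kernel datum and its exact shadow is
`(Σ uVA + Σ uVB)² + (Σ dPA + Σ dPB)² + V (Σ uPA + Σ uPB)²`; by `(x+y)² ≤ 2x² + 2y²`,
`V(Σ uPA + Σ uPB)² ≤ W₀ (Σ ι uPA + Σ ι uPB)²` (`ι = 1/x`) and the six `L²` bounds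
(`kernelTransfer_core`):

  `∫_{x>ρ} (…) ≤ (Kt/ρ) (Σ_k a_k² ρ^{4k−2ℓ−1} + Σ_k b_k² ρ^{4k−2ℓ+1})`,
  `Kt = (ℓ+1) K² (2ℓ+1)² (Σ_k c_{2k}⁻²) (4 + 2W₀)`.

The literal (unfolded) form used by the far-side channel estimate is `kernelTransfer_energy_le`
(`FarChannelsKernelTransfer.lean`). Route PhotonSphereChannels, `FixedModeChannels`, far side
(stmt-FinalStateConjecture-10048). Folklore.
-/

noncomputable section

namespace Literature.Analysis.PDE

open MeasureTheory Set Filter Topology Finset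

variable {ι V : ℝ → ℝ} {E : ℕ → ℝ → ℝ} {ℓ : ℕ} {x₁ K W₀ : ℝ}

/-- **Kernel transfer inequality, family form.** [folklore] -/
theorem kernelTransfer_core (hι : ContDiff ℝ (⊤ : ℕ∞) ι)
    (hιeq : ∀ x : ℝ, 1 / 2 ≤ x → ι x = x⁻¹) (hx₁ : 1 ≤ x₁) (hW₀ : 0 ≤ W₀)
    (hEC : ∀ j, j ≤ ℓ → ContDiff ℝ 2 (E j))
    (hEb : ∀ j, j ≤ ℓ → ∀ x, x₁ ≤ x →
      |E j x - (∏ i ∈ range ℓ, ((j : ℝ) - 2 * i - 1)) * ι x ^ (ℓ - j)| ≤ K * x ^ ((j : ℝ) - ℓ - 1 / 2) ∧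
      |deriv (E j) x - deriv (fun y => (∏ i ∈ range ℓ, ((j : ℝ) - 2 * i - 1)) * ι y ^ (ℓ - j)) x|
        ≤ K * x ^ ((j : ℝ) - ℓ - 3 / 2))
    (hV : Continuous V) (hV0 : ∀ x, 0 ≤ V x) (hVW : ∀ x, x₁ ≤ x → V x ≤ W₀ * x ^ (-(2 : ℝ))) :
    ∃ Kt : ℝ, 0 ≤ Kt ∧ ∀ (a b : ℕ → ℝ) (ρ : ℝ), x₁ ≤ ρ → ∀ (cE : ℕ → ℝ),
      (∀ k, cE k = ∏ i ∈ range ℓ, (((2 * k : ℕ) : ℝ) - 2 * i - 1)) →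
      ∀ (uVA uVB uPA uPB dPA dPB : ℕ → ℝ → ℝ),
      (∀ k z, uVA k z = a k / cE k * ((2 * k : ℕ) : ℝ) * E (2 * k - 1) z) →
      (∀ k z, uVB k z = b k / cE k * (E (2 * k) z - cE k * ι z ^ (ℓ - 2 * k))) →
      (∀ k z, uPA k z = a k / cE k * (E (2 * k) z - cE k * ι z ^ (ℓ - 2 * k))) →
      (∀ k z, uPB k z = b k / (((2 * k + 1 : ℕ) : ℝ) * cE k) * E (2 * k + 1) z) →
      (∀ k z, dPA k z
        = a k / cE k * (deriv (E (2 * k)) z - deriv (fun y => cE k * ι y ^ (ℓ - 2 * k)) z)) →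
      (∀ k z, dPB k z = b k / (((2 * k + 1 : ℕ) : ℝ) * cE k) * deriv (E (2 * k + 1)) z) →
      IntegrableOn (fun z =>
          (∑ k ∈ range (ℓ / 2 + 1), uVA k z + ∑ k ∈ range ((ℓ + 1) / 2), uVB k z) ^ 2
          + (∑ k ∈ range (ℓ / 2 + 1), dPA k z + ∑ k ∈ range ((ℓ + 1) / 2), dPB k z) ^ 2
          + V z * (∑ k ∈ range (ℓ / 2 + 1), uPA k z + ∑ k ∈ range ((ℓ + 1) / 2), uPB k z) ^ 2)
        (Ioi ρ) ∧
      ∫ z in Ioi ρ,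
          ((∑ k ∈ range (ℓ / 2 + 1), uVA k z + ∑ k ∈ range ((ℓ + 1) / 2), uVB k z) ^ 2
          + (∑ k ∈ range (ℓ / 2 + 1), dPA k z + ∑ k ∈ range ((ℓ + 1) / 2), dPB k z) ^ 2
          + V z * (∑ k ∈ range (ℓ / 2 + 1), uPA k z + ∑ k ∈ range ((ℓ + 1) / 2), uPB k z) ^ 2)
        ≤ Kt / ρ * (∑ k ∈ range (ℓ / 2 + 1), a k ^ 2 * ρ ^ (4 * (k : ℝ) - 2 * ℓ - 1)
          + ∑ k ∈ range ((ℓ + 1) / 2), b k ^ 2 * ρ ^ (4 * (k : ℝ) - 2 * ℓ + 1)) := by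
  set C₀ : ℝ := ∑ k ∈ range (ℓ / 2 + 1),
    ((∏ i ∈ range ℓ, (((2 * k : ℕ) : ℝ) - 2 * i - 1)) ^ 2)⁻¹ with hC₀
  have hC₀0 : 0 ≤ C₀ := Finset.sum_nonneg fun k _ => by positivity
  set Kt : ℝ := ((ℓ : ℝ) + 1) * (K ^ 2 * (2 * (ℓ : ℝ) + 1) ^ 2 * C₀) * (4 + 2 * W₀) with hKt
  have hsq : ∀ x y : ℝ, (x + y) ^ 2 ≤ 2 * x ^ 2 + 2 * y ^ 2 := fun x y => by
    linarith only [sq_nonneg (x - y)]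
  have hW2 : (0 : ℝ) ≤ 2 * W₀ := by positivity
  have h02 : (0 : ℝ) ≤ 2 := by norm_num
  refine ⟨Kt, by positivity, ?_⟩
  intro a b ρ hρ cE hcE uVA uVB uPA uPB dPA dPB huVA huVB huPA huPB hdPA hdPB
  have hρ1 : 1 ≤ ρ := hx₁.trans hρ
  have hρ0 : 0 < ρ := lt_of_lt_of_le one_pos hρ1
  have hιz : ∀ z, ρ ≤ z → ι z = z⁻¹ := fun z hz => hιeq z (by linarith only [hz, hρ1])
  have hCE : ∑ k ∈ range (ℓ / 2 + 1), ((cE k) ^ 2)⁻¹ = C₀ := by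
    rw [hC₀]; exact Finset.sum_congr rfl fun k _ => by rw [hcE]
  obtain ⟨⟨cVA, cVB, cPA, cPB, cdA, cdB⟩, ⟨i1, T1⟩, ⟨i2, T2⟩, ⟨i3, T3⟩, ⟨i4, T4⟩, ⟨i5, T5⟩,
    ⟨i6, T6⟩⟩ := kernelTransfer_family_bounds hι hιeq hx₁ hEC hEb a b hρ cE hcE uVA uVB uPA uPB
      dPA dPB huVA huVB huPA huPB hdPA hdPB
  rw [hCE] at T1 T2 T3 T4 T5 T6
  -- pointwise domination
  have hdom : ∀ z ∈ Ioi ρ,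
      (∑ k ∈ range (ℓ / 2 + 1), uVA k z + ∑ k ∈ range ((ℓ + 1) / 2), uVB k z) ^ 2
          + (∑ k ∈ range (ℓ / 2 + 1), dPA k z + ∑ k ∈ range ((ℓ + 1) / 2), dPB k z) ^ 2
          + V z * (∑ k ∈ range (ℓ / 2 + 1), uPA k z + ∑ k ∈ range ((ℓ + 1) / 2), uPB k z) ^ 2
        ≤ (2 * (∑ k ∈ range (ℓ / 2 + 1), uVA k z) ^ 2
            + 2 * (∑ k ∈ range ((ℓ + 1) / 2), uVB k z) ^ 2)
          + (2 * (∑ k ∈ range (ℓ / 2 + 1), dPA k z) ^ 2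
            + 2 * (∑ k ∈ range ((ℓ + 1) / 2), dPB k z) ^ 2)
          + (2 * W₀ * (∑ k ∈ range (ℓ / 2 + 1), ι z * uPA k z) ^ 2
            + 2 * W₀ * (∑ k ∈ range ((ℓ + 1) / 2), ι z * uPB k z) ^ 2) := by
    intro z hz
    have hz' : ρ ≤ z := le_of_lt hz
    have hz0 : 0 < z := hρ0.trans hz
    have hVz : V z ≤ W₀ * z ^ (-(2 : ℝ)) := hVW z (hρ.trans hz')
    have hw : z ^ (-(2 : ℝ))
          * (∑ k ∈ range (ℓ / 2 + 1), uPA k z + ∑ k ∈ range ((ℓ + 1) / 2), uPB k z) ^ 2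
        = (∑ k ∈ range (ℓ / 2 + 1), ι z * uPA k z
            + ∑ k ∈ range ((ℓ + 1) / 2), ι z * uPB k z) ^ 2 := by
      rw [← Finset.mul_sum, ← Finset.mul_sum, ← mul_add, mul_pow, hιz z hz',
        Real.rpow_neg hz0.le, Real.rpow_two, inv_pow]
    refine add_le_add (add_le_add (hsq _ _) (hsq _ _)) ?_
    calc V z * (∑ k ∈ range (ℓ / 2 + 1), uPA k z + ∑ k ∈ range ((ℓ + 1) / 2), uPB k z) ^ 2
        ≤ W₀ * z ^ (-(2 : ℝ))
            * (∑ k ∈ range (ℓ / 2 + 1), uPA k z + ∑ k ∈ range ((ℓ + 1) / 2), uPB k z) ^ 2 :=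
          mul_le_mul_of_nonneg_right hVz (sq_nonneg _)
      _ = W₀ * (∑ k ∈ range (ℓ / 2 + 1), ι z * uPA k z
            + ∑ k ∈ range ((ℓ + 1) / 2), ι z * uPB k z) ^ 2 := by rw [mul_assoc, hw]
      _ ≤ W₀ * (2 * (∑ k ∈ range (ℓ / 2 + 1), ι z * uPA k z) ^ 2
            + 2 * (∑ k ∈ range ((ℓ + 1) / 2), ι z * uPB k z) ^ 2) :=
          mul_le_mul_of_nonneg_left (hsq _ _) hW₀
      _ = _ := by ring
  -- integrability of the majorant and of the integrand
  have hGi : IntegrableOn (fun z =>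
      (2 * (∑ k ∈ range (ℓ / 2 + 1), uVA k z) ^ 2
            + 2 * (∑ k ∈ range ((ℓ + 1) / 2), uVB k z) ^ 2)
          + (2 * (∑ k ∈ range (ℓ / 2 + 1), dPA k z) ^ 2
            + 2 * (∑ k ∈ range ((ℓ + 1) / 2), dPB k z) ^ 2)
          + (2 * W₀ * (∑ k ∈ range (ℓ / 2 + 1), ι z * uPA k z) ^ 2
            + 2 * W₀ * (∑ k ∈ range ((ℓ + 1) / 2), ι z * uPB k z) ^ 2)) (Ioi ρ) :=
    (((i1.const_mul 2).fun_add (i2.const_mul 2)).fun_add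
      ((i3.const_mul 2).fun_add (i4.const_mul 2))).fun_add
      ((i5.const_mul (2 * W₀)).fun_add (i6.const_mul (2 * W₀)))
  have hIc : Continuous fun z =>
      (∑ k ∈ range (ℓ / 2 + 1), uVA k z + ∑ k ∈ range ((ℓ + 1) / 2), uVB k z) ^ 2
          + (∑ k ∈ range (ℓ / 2 + 1), dPA k z + ∑ k ∈ range ((ℓ + 1) / 2), dPB k z) ^ 2
          + V z * (∑ k ∈ range (ℓ / 2 + 1), uPA k z + ∑ k ∈ range ((ℓ + 1) / 2), uPB k z) ^ 2 :=
    ((((continuous_finsetSum _ cVA).add (continuous_finsetSum _ cVB)).pow 2).add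
      (((continuous_finsetSum _ cdA).add (continuous_finsetSum _ cdB)).pow 2)).add
      (hV.mul (((continuous_finsetSum _ cPA).add (continuous_finsetSum _ cPB)).pow 2))
  have hIi : IntegrableOn (fun z =>
      (∑ k ∈ range (ℓ / 2 + 1), uVA k z + ∑ k ∈ range ((ℓ + 1) / 2), uVB k z) ^ 2
          + (∑ k ∈ range (ℓ / 2 + 1), dPA k z + ∑ k ∈ range ((ℓ + 1) / 2), dPB k z) ^ 2
          + V z * (∑ k ∈ range (ℓ / 2 + 1), uPA k z + ∑ k ∈ range ((ℓ + 1) / 2), uPB k z) ^ 2)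
      (Ioi ρ) :=
    Integrable.mono' hGi hIc.aestronglyMeasurable ((ae_restrict_iff' measurableSet_Ioi).2
      (ae_of_all _ fun z hz => by
        rw [Real.norm_eq_abs, abs_of_nonneg (add_nonneg (add_nonneg (sq_nonneg _) (sq_nonneg _))
          (mul_nonneg (hV0 z) (sq_nonneg _)))]
        exact hdom z hz))
  refine ⟨hIi, ?_⟩
  -- integrate
  have e12 : ∫ z in Ioi ρ, (2 * (∑ k ∈ range (ℓ / 2 + 1), uVA k z) ^ 2
        + 2 * (∑ k ∈ range ((ℓ + 1) / 2), uVB k z) ^ 2)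
      = 2 * (∫ z in Ioi ρ, (∑ k ∈ range (ℓ / 2 + 1), uVA k z) ^ 2)
        + 2 * ∫ z in Ioi ρ, (∑ k ∈ range ((ℓ + 1) / 2), uVB k z) ^ 2 := by
    rw [integral_add (i1.const_mul 2) (i2.const_mul 2), integral_const_mul, integral_const_mul]
  have e34 : ∫ z in Ioi ρ, (2 * (∑ k ∈ range (ℓ / 2 + 1), dPA k z) ^ 2
        + 2 * (∑ k ∈ range ((ℓ + 1) / 2), dPB k z) ^ 2)
      = 2 * (∫ z in Ioi ρ, (∑ k ∈ range (ℓ / 2 + 1), dPA k z) ^ 2)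
        + 2 * ∫ z in Ioi ρ, (∑ k ∈ range ((ℓ + 1) / 2), dPB k z) ^ 2 := by
    rw [integral_add (i3.const_mul 2) (i4.const_mul 2), integral_const_mul, integral_const_mul]
  have e56 : ∫ z in Ioi ρ, (2 * W₀ * (∑ k ∈ range (ℓ / 2 + 1), ι z * uPA k z) ^ 2
        + 2 * W₀ * (∑ k ∈ range ((ℓ + 1) / 2), ι z * uPB k z) ^ 2)
      = 2 * W₀ * (∫ z in Ioi ρ, (∑ k ∈ range (ℓ / 2 + 1), ι z * uPA k z) ^ 2)
        + 2 * W₀ * ∫ z in Ioi ρ, (∑ k ∈ range ((ℓ + 1) / 2), ι z * uPB k z) ^ 2 := by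
    rw [integral_add (i5.const_mul _) (i6.const_mul _), integral_const_mul, integral_const_mul]
  have etot := integral_add (μ := volume.restrict (Ioi ρ))
    (((i1.const_mul 2).fun_add (i2.const_mul 2)).fun_add
      ((i3.const_mul 2).fun_add (i4.const_mul 2)))
    ((i5.const_mul (2 * W₀)).fun_add (i6.const_mul (2 * W₀)))
  have etot' := integral_add (μ := volume.restrict (Ioi ρ))
    ((i1.const_mul 2).fun_add (i2.const_mul 2)) ((i3.const_mul 2).fun_add (i4.const_mul 2))
  calc _ ≤ ∫ z in Ioi ρ, ((2 * (∑ k ∈ range (ℓ / 2 + 1), uVA k z) ^ 2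
            + 2 * (∑ k ∈ range ((ℓ + 1) / 2), uVB k z) ^ 2)
          + (2 * (∑ k ∈ range (ℓ / 2 + 1), dPA k z) ^ 2
            + 2 * (∑ k ∈ range ((ℓ + 1) / 2), dPB k z) ^ 2)
          + (2 * W₀ * (∑ k ∈ range (ℓ / 2 + 1), ι z * uPA k z) ^ 2
            + 2 * W₀ * (∑ k ∈ range ((ℓ + 1) / 2), ι z * uPB k z) ^ 2)) :=
        setIntegral_mono_on hIi hGi measurableSet_Ioi hdom
    _ = (2 * (∫ z in Ioi ρ, (∑ k ∈ range (ℓ / 2 + 1), uVA k z) ^ 2)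
          + 2 * ∫ z in Ioi ρ, (∑ k ∈ range ((ℓ + 1) / 2), uVB k z) ^ 2)
        + (2 * (∫ z in Ioi ρ, (∑ k ∈ range (ℓ / 2 + 1), dPA k z) ^ 2)
          + 2 * ∫ z in Ioi ρ, (∑ k ∈ range ((ℓ + 1) / 2), dPB k z) ^ 2)
        + (2 * W₀ * (∫ z in Ioi ρ, (∑ k ∈ range (ℓ / 2 + 1), ι z * uPA k z) ^ 2)
          + 2 * W₀ * ∫ z in Ioi ρ, (∑ k ∈ range ((ℓ + 1) / 2), ι z * uPB k z) ^ 2) := by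
        rw [etot, etot', e12, e34, e56]
    _ ≤ (2 * (((ℓ : ℝ) + 1) * (K ^ 2 * (2 * (ℓ : ℝ) + 1) ^ 2 * C₀ * ρ⁻¹
            * ∑ k ∈ range (ℓ / 2 + 1), a k ^ 2 * ρ ^ (4 * (k : ℝ) - 2 * ℓ - 1)))
          + 2 * (((ℓ : ℝ) + 1) * (K ^ 2 * (2 * (ℓ : ℝ) + 1) ^ 2 * C₀ * ρ⁻¹
            * ∑ k ∈ range ((ℓ + 1) / 2), b k ^ 2 * ρ ^ (4 * (k : ℝ) - 2 * ℓ + 1))))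
        + (2 * (((ℓ : ℝ) + 1) * (K ^ 2 * (2 * (ℓ : ℝ) + 1) ^ 2 * C₀ * ρ⁻¹
            * ∑ k ∈ range (ℓ / 2 + 1), a k ^ 2 * ρ ^ (4 * (k : ℝ) - 2 * ℓ - 1)))
          + 2 * (((ℓ : ℝ) + 1) * (K ^ 2 * (2 * (ℓ : ℝ) + 1) ^ 2 * C₀ * ρ⁻¹
            * ∑ k ∈ range ((ℓ + 1) / 2), b k ^ 2 * ρ ^ (4 * (k : ℝ) - 2 * ℓ + 1))))
        + (2 * W₀ * (((ℓ : ℝ) + 1) * (K ^ 2 * (2 * (ℓ : ℝ) + 1) ^ 2 * C₀ * ρ⁻¹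
            * ∑ k ∈ range (ℓ / 2 + 1), a k ^ 2 * ρ ^ (4 * (k : ℝ) - 2 * ℓ - 1)))
          + 2 * W₀ * (((ℓ : ℝ) + 1) * (K ^ 2 * (2 * (ℓ : ℝ) + 1) ^ 2 * C₀ * ρ⁻¹
            * ∑ k ∈ range ((ℓ + 1) / 2), b k ^ 2 * ρ ^ (4 * (k : ℝ) - 2 * ℓ + 1)))) :=
        add_le_add (add_le_add
          (add_le_add (mul_le_mul_of_nonneg_left T1 h02) (mul_le_mul_of_nonneg_left T2 h02))
          (add_le_add (mul_le_mul_of_nonneg_left T3 h02) (mul_le_mul_of_nonneg_left T4 h02)))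
          (add_le_add (mul_le_mul_of_nonneg_left T5 hW2) (mul_le_mul_of_nonneg_left T6 hW2))
    _ = Kt / ρ * (∑ k ∈ range (ℓ / 2 + 1), a k ^ 2 * ρ ^ (4 * (k : ℝ) - 2 * ℓ - 1)
          + ∑ k ∈ range ((ℓ + 1) / 2), b k ^ 2 * ρ ^ (4 * (k : ℝ) - 2 * ℓ + 1)) := by
        rw [hKt, div_eq_mul_inv]
        ring

end Literature.Analysis.PDE
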